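import Summits.AtomisticToContinuum.BoseEinsteinCondensation.Theorems.BECThomsonPrincipleGDTransferSeededSpectralIntDefs
import Summits.AtomisticToContinuum.BoseEinsteinCondensation.Theorems.BECThomsonPrincipleGDTransferSeededInteractionLocality

/-!
# Route `BECThomsonPrinciple`, crux `GDTransfer` (stmt-AtomisticToContinuum-9482), line `seeded-continuity`:
# sub-goal `interactionLocalityInt` — the interaction form has `Q_S`-bandwidth two, INTEGRABLE class

Supports (does not close) stmt-AtomisticToContinuum-9482.  Registered sub-goal
`interactionLocalityInt : InteractionLocalityInt` of the eighth Defs file `…SeededSpectralIntDefs` (spectral seed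
programme, wave 3: the integrable twin round): for an admissible profile `v` finite on `[0, ∞)` with integrable lift
(`IsIntegrableProfile v`), `L > 0` and continuous `f`, `𝓥(Q_S f, Q_T f) = 0` as soon as `T ∖ S` has at least three
elements.  Twin of `interactionLocality` (`…SeededInteractionLocality`, finite continuous class).

Proof (same mechanism, integrable weights).  The periodisation of `v` is finite everywhere
(`PlainInteraction.periodizedPotential_ne_top_of_finite`), so the real interaction is the finite sum of the real
pair weights `w_{pq}(X) = v^per(x_p − x_q)` (`toReal_periodicInteraction_int`), each of which is in `L¹(cell^N)`
(`integrableOn_pairWeight`); hence `𝓥(Q_S f, Q_T g) = Σ_{p<q} ∫ w_{pq} conj(Q_S f) Q_T g` (`form_sum_weight_int`).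
For the pair `{p, q}` pick `l ∈ T ∖ S ∖ {p, q}` (`exists_mem_sdiff_ne_ne`).  Then `P_l Q_T g = Q_T g`,
`P_l Q_S f = 0` (`Lnss.cellAvg_modeProj`), the weight is flat in slot `l` (`pairWeight_update`) and so passes
through `P_l` (`cellAvg_mul_flat`): `H := w · Q_T g ∈ L¹(cell^N)` has `P_l H = H`, and `P_l` is self-adjoint with
one continuous and one integrable entry (`integral_conj_mul_cellAvg_int`):
`∫ w conj(Q_S f) Q_T g = ∫ conj(Q_S f) P_l H = ∫ conj(P_l Q_S f) H = 0`.
[folklore] (ReedSimonIV1978 §XIII.12, IMS-type localisation; LSSY2005 App. A.)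
-/

noncomputable section

open MeasureTheory Filter
open scoped ENNReal NNReal ComplexConjugate

namespace Summit.AtomisticToContinuum.BoseEinsteinCondensation.Cruxes.GDTransfer.Seeded

namespace InteractionLocalityIntProof

open Literature.MathematicalPhysics.QuantumManyBody.BoseGas
open Summit.AtomisticToContinuum.BoseEinsteinCondensation.Theorems.GaussianDominationCan.Negative
open Summit.AtomisticToContinuum.BoseEinsteinCondensation.Cruxes.GDTransfer.DysonDressedWitness
open Lnss PlainInteraction InteractionLocalityProof

variable {m : ℕ} {L : ℝ}

/-- **One slot kills a weighted cross form, integrable weight.**  For a real weight `w ∈ L¹(cell^N)` flat in a slot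
`l ∈ T`, `l ∉ S`, and continuous `f, g`: `∫ w conj(Q_S f) (Q_T g) = 0` over `cell^N` (`P_l` is self-adjoint with one
integrable entry, commutes with `w`, fixes `Q_T g` and kills `Q_S f`). [folklore] -/
theorem form_modeProj_eq_zero_of_flat_int (hL : 0 < L) {S T : Finset (Fin (m + 1))} {l : Fin (m + 1)}
    (hlT : l ∈ T) (hlS : l ∉ S) {w : Config (m + 1) → ℝ} (hw : IntegrableOn w (cellN (m + 1) L))
    (hwl : ∀ X z, w (Function.update X l z) = w X) {f g : Config (m + 1) → ℂ} (hf : Continuous f)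
    (hg : Continuous g) :
    ∫ X in cellN (m + 1) L, ((w X : ℝ) : ℂ) *
        (conj (modeProj (m + 1) L S f X) * modeProj (m + 1) L T g X) = 0 := by
  -- adapted from `InteractionLocalityProof.form_modeProj_eq_zero_of_flat` (continuous weight)
  have hFc : Continuous (modeProj (m + 1) L S f) := ChordVariation.continuous_modeProj S hf
  have hGc : Continuous (modeProj (m + 1) L T g) := ChordVariation.continuous_modeProj T hg
  -- `P_l Q_T g = Q_T g`, `P_l Q_S f = 0`
  have hPG : cellAvg (m + 1) L l (modeProj (m + 1) L T g) = modeProj (m + 1) L T g := by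
    rw [cellAvg_modeProj hL T l hg, if_pos hlT]
  have hPF : cellAvg (m + 1) L l (modeProj (m + 1) L S f) = 0 := by
    rw [cellAvg_modeProj hL S l hf, if_neg hlS]
  -- `H = w · Q_T g` is integrable on the cell and `P_l H = w · P_l Q_T g = H`
  set H : Config (m + 1) → ℂ := fun X => ((w X : ℝ) : ℂ) * modeProj (m + 1) L T g X with hH
  have hHi : IntegrableOn H (cellN (m + 1) L) := integrable_weight_mul hw hGc
  have hwu : ∀ (X : Config (m + 1)) (z : Space),
      (((w (Function.update X l z) : ℝ) : ℂ)) = ((w X : ℝ) : ℂ) := fun X z => by rw [hwl]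
  have hPH : cellAvg (m + 1) L l H = H := by
    rw [hH, cellAvg_mul_flat l hwu (modeProj (m + 1) L T g), hPG]
  calc ∫ X in cellN (m + 1) L, ((w X : ℝ) : ℂ) *
        (conj (modeProj (m + 1) L S f X) * modeProj (m + 1) L T g X)
      = ∫ X in cellN (m + 1) L, conj (modeProj (m + 1) L S f X) * cellAvg (m + 1) L l H X := by
        rw [hPH]
        refine integral_congr_ae (Eventually.of_forall fun X => ?_)
        simp only [hH]
        ring
    _ = ∫ X in cellN (m + 1) L, conj (cellAvg (m + 1) L l (modeProj (m + 1) L S f) X) * H X :=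
        integral_conj_mul_cellAvg_int l hFc hHi
    _ = 0 := by
        rw [hPF]
        simp only [Pi.zero_apply, map_zero, zero_mul, integral_zero]

/-- **The interaction cross form pair by pair**, finite periodisation and integrable lift: for continuous `f, g`,
`𝓥(Q_S f, Q_T g) = Σ_p Σ_{q>p} ∫ v^per(x_p − x_q) conj(Q_S f) Q_T g` (the pair weights are in `L¹(cell^N)`).
[folklore] -/
theorem vform_modeProj_eq_sum_pairs_int {v : ℝ → ℝ≥0∞} (hL : 0 < L) (hv : IsRepulsiveFiniteRange v)
    (hfin : ∀ x, periodizedPotential v L x ≠ ⊤) (hint : (∫⁻ x : Space, v ‖x‖) ≠ ⊤)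
    (S T : Finset (Fin (m + 1))) {f g : Config (m + 1) → ℂ} (hf : Continuous f) (hg : Continuous g) :
    vform v m L (modeProj (m + 1) L S f) (modeProj (m + 1) L T g) =
      ∑ p : Fin (m + 1), ∑ q ∈ (Finset.univ : Finset (Fin (m + 1))).filter (fun q => p < q),
        ∫ X in cellN (m + 1) L, (((periodizedPotential v L (X p - X q)).toReal : ℝ) : ℂ) *
          (conj (modeProj (m + 1) L S f X) * modeProj (m + 1) L T g X) := by
  -- adapted from `InteractionLocalityProof.vform_modeProj_eq_sum_pairs` (continuous pair weights)
  have hFc : Continuous (modeProj (m + 1) L S f) := ChordVariation.continuous_modeProj S hf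
  have hGc : Continuous (modeProj (m + 1) L T g) := ChordVariation.continuous_modeProj T hg
  have hpair : ∀ p q : Fin (m + 1),
      IntegrableOn (fun X : Config (m + 1) => (periodizedPotential v L (X p - X q)).toReal) (cellN (m + 1) L) :=
    fun p q => integrableOn_pairWeight hL hv hint p q
  have hrow : ∀ p : Fin (m + 1), IntegrableOn (fun X : Config (m + 1) =>
      ∑ q ∈ (Finset.univ : Finset (Fin (m + 1))).filter (fun q => p < q),
        (periodizedPotential v L (X p - X q)).toReal) (cellN (m + 1) L) :=
    fun p => integrable_finsetSum _ fun q _ => hpair p q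
  unfold vform
  calc ∫ X in cellN (m + 1) L, (((periodicInteraction v L X).toReal : ℝ) : ℂ) *
        (conj (modeProj (m + 1) L S f X) * modeProj (m + 1) L T g X)
      = ∫ X in cellN (m + 1) L, ((∑ p : Fin (m + 1),
          ∑ q ∈ (Finset.univ : Finset (Fin (m + 1))).filter (fun q => p < q),
            (periodizedPotential v L (X p - X q)).toReal : ℝ) : ℂ) *
          (conj (modeProj (m + 1) L S f X) * modeProj (m + 1) L T g X) := by
        refine integral_congr_ae (Eventually.of_forall fun X => ?_)
        beta_reduce
        rw [toReal_periodicInteraction_int hfin]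
    _ = ∑ p : Fin (m + 1), ∫ X in cellN (m + 1) L,
          ((∑ q ∈ (Finset.univ : Finset (Fin (m + 1))).filter (fun q => p < q),
            (periodizedPotential v L (X p - X q)).toReal : ℝ) : ℂ) *
          (conj (modeProj (m + 1) L S f X) * modeProj (m + 1) L T g X) :=
        form_sum_weight_int (w := fun p X => ∑ q ∈ (Finset.univ : Finset (Fin (m + 1))).filter (fun q => p < q),
          (periodizedPotential v L (X p - X q)).toReal) Finset.univ (fun p _ => hrow p) hFc hGc
    _ = ∑ p : Fin (m + 1), ∑ q ∈ (Finset.univ : Finset (Fin (m + 1))).filter (fun q => p < q),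
          ∫ X in cellN (m + 1) L, (((periodizedPotential v L (X p - X q)).toReal : ℝ) : ℂ) *
            (conj (modeProj (m + 1) L S f X) * modeProj (m + 1) L T g X) :=
        Finset.sum_congr rfl fun p _ =>
          form_sum_weight_int (w := fun q X => (periodizedPotential v L (X p - X q)).toReal) _
            (fun q _ => hpair p q) hFc hGc

/-- **`Q_S`-bandwidth two, two-function form**, finite periodisation and integrable lift: for `L > 0`,
`|T ∖ S| ≥ 3` and continuous `f, g`, `𝓥(Q_S f, Q_T g) = 0`. [folklore] -/
theorem vform_modeProj_eq_zero_int {v : ℝ → ℝ≥0∞} (hL : 0 < L) (hv : IsRepulsiveFiniteRange v)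
    (hfin : ∀ x, periodizedPotential v L x ≠ ⊤) (hint : (∫⁻ x : Space, v ‖x‖) ≠ ⊤)
    {S T : Finset (Fin (m + 1))} (hcard : 3 ≤ (T \ S).card) {f g : Config (m + 1) → ℂ}
    (hf : Continuous f) (hg : Continuous g) :
    vform v m L (modeProj (m + 1) L S f) (modeProj (m + 1) L T g) = 0 := by
  rw [vform_modeProj_eq_sum_pairs_int hL hv hfin hint S T hf hg]
  refine Finset.sum_eq_zero fun p _ => Finset.sum_eq_zero fun q _ => ?_
  obtain ⟨l, hlT, hlS, hpl, hql⟩ := exists_mem_sdiff_ne_ne hcard p q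
  exact form_modeProj_eq_zero_of_flat_int hL hlT hlS (integrableOn_pairWeight hL hv hint p q)
    (fun X z => pairWeight_update v L hpl hql X z) hf hg

end InteractionLocalityIntProof

/-- **THE INTERACTION FORM HAS `Q_S`-BANDWIDTH TWO, INTEGRABLE CLASS** (registered sub-goal `interactionLocalityInt`
of the spectral seed programme, line `seeded-continuity`; twin of `interactionLocality`): for an admissible profile
`v` finite on `[0, ∞)` with integrable lift, `L > 0`, continuous `f` and `|T ∖ S| ≥ 3`, `𝓥(Q_S f, Q_T f) = 0` — the
periodisation is finite, the pair weights `v^per(x_p − x_q)` are in `L¹(cell^N)`, and for every pair `{p, q}` some slot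
`l ∈ T ∖ S` outside the pair is flat for the weight, with `P_l` self-adjoint (one integrable entry), `P_l Q_T f = Q_T f`,
`P_l Q_S f = 0`. [folklore] (ReedSimonIV1978 §XIII.12; LSSY2005 App. A.) -/
theorem interactionLocalityInt : InteractionLocalityInt :=
  fun _ hv hvi _ _ hL _ _ hcard _ hf =>
    InteractionLocalityIntProof.vform_modeProj_eq_zero_int hL hv
      (PlainInteraction.periodizedPotential_ne_top_of_finite hv hvi.1 hL) hvi.2 hcard hf hf

end Summit.AtomisticToContinuum.BoseEinsteinCondensation.Cruxes.GDTransfer.Seeded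

end
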